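import Mathlib
import HarnessLib
import Summits.ValiantsHypothesis.ValiantsHypothesis.Theorems.MonotoneRestorationOrbitRestorationQPInjectivePlacementsPoly

/-!
# The separable engine: core patterns have treewidth `≤ c + 1`, so all-placements sums of ROW-SEPARABLE products are narrow

Route MonotoneRestoration, crux `OrbitRestorationQP` (stmt-ValiantsHypothesis-18293), SPAN-currency lane of the open
sub-rung A_∞ (`stub_sigmaPiSigmaValue`), `ΠΣ` part; repair-census item "SEPARABLE ENGINE" of `BLOCK-LANE-g7g5.md` (R3,
the sign-twisted support blocks).  Helper (`--supports`), def-free.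

The engine of the lane (`CorePatterns.sum_placements_aeval_mem_narrowSpan`: all-placements sums of a polynomial in
the local atoms `x_{ab}`, `R_a`, `C_b` of a core `Fin r × Fin c` lie in `span_ℂ {hom_{F,n} : tw F ≤ r + c}`) charges
the full core size.  The core-pattern graph, however, is a bipartite graph between the `r` core rows and the `c` core
columns with pendant leaves, and the path decomposition with bags "all core columns + ONE core row + one of its
pendants" (then "all core columns + one fresh row") has width `c + 1`, independently of `r`:

* `treewidth_corePattern_le_col` — core patterns have treewidth `≤ c + 1` (grid decomposition
  `Literature.Combinatorics.SimpleGraph.treewidth_le_of_grid`, rows of the grid = core rows then fresh rows, columns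
  of the grid = the row-pendant slots);
* `corePattern_mem_narrowSpan_col`, **`sum_placements_aeval_mem_narrowSpan_col`** — THE SEPARABLE ENGINE: for every
  polynomial `P` in the local atoms of a core `Fin r × Fin c`, `Σ_{φ,ψ} P(x_{φ a, ψ b}, R_{φ a}, C_{ψ b})` lies in
  `span_ℂ {hom_{F,n} : tw F ≤ c + 1}` — ANY number `r` of rows;
* `sum_injective_placements_aeval_mem_narrowSpan_col`, `sum_injective_injective_aeval_mem_narrowSpan_col` — the same
  for injective placements (generic inclusion–exclusion `CorePatterns.sum_injective_mem_of_merge`).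

Why (lane note): in the sign-twisted residue the column-label groupings `G_T` of the blocks are ROW-(anti)symmetric
polynomials in the atoms of the rows meeting the columns `T`; pairing two of them (`G_T · G_{T'}`, Gram / multisymmetric
expansion) gives polynomials in the row-placement SUPER-ATOMS `Σ_a Π_{b∈T∪T'} x_{ab}^{α_b} R_a^ν`, i.e. all-placements
sums over MANY rows of monomials with a column core of size `≤ 2(k − 1)`; this file makes their treewidth charge
`|T ∪ T'| + 1` instead of `(number of rows) + |T ∪ T'|`.  No registered stub is closed; the crux and VP ≠ VNP are not
moved. [folklore; cite: DwivediPagoSeppelt2026, §8]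
-/

noncomputable section

-- `Summit.ValiantsHypothesis.ValiantsHypothesis.…` is the tree's single-conjunct layout (Sub = Summit).
set_option linter.dupNamespace false

namespace Summit.ValiantsHypothesis.ValiantsHypothesis.Theorems

namespace CorePatterns

open MvPolynomial Finset
open Literature.Computability.AlgebraicComplexity (homPoly)
open Literature.Combinatorics.SimpleGraph (treewidth treewidth_le_of_grid)

/-! ### Core patterns have treewidth `≤ c + 1` -/

/-- **Core patterns have treewidth `≤ c + 1`** (independently of the number `r` of core rows): the bags
"core columns + core row `a` (+ one row-pendant of `a`)" followed by "core columns + one fresh row", read along a grid,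
form a path decomposition. [folklore] -/
theorem treewidth_corePattern_le_col (r c m₁ m₂ m₃ : ℕ) (cells : Fin m₁ → Fin r × Fin c) (rp : Fin m₂ → Fin r)
    (cp : Fin m₃ → Fin c) :
    treewidth (SimpleGraph.fromRel fun u v : (Fin r ⊕ Fin m₃) ⊕ (Fin c ⊕ Fin m₂) =>
      ∃ e ∈ ((∑ i : Fin m₁, ({((Sum.inl (cells i).1 : Fin r ⊕ Fin m₃), (Sum.inl (cells i).2 : Fin c ⊕ Fin m₂))} :
          Multiset ((Fin r ⊕ Fin m₃) × (Fin c ⊕ Fin m₂)))) +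
        (∑ i : Fin m₂, ({((Sum.inl (rp i) : Fin r ⊕ Fin m₃), (Sum.inr i : Fin c ⊕ Fin m₂))} :
          Multiset ((Fin r ⊕ Fin m₃) × (Fin c ⊕ Fin m₂)))) +
        (∑ i : Fin m₃, ({((Sum.inr i : Fin r ⊕ Fin m₃), (Sum.inl (cp i) : Fin c ⊕ Fin m₂))} :
          Multiset ((Fin r ⊕ Fin m₃) × (Fin c ⊕ Fin m₂))))),
        u = Sum.inl e.1 ∧ v = Sum.inr e.2) ≤ c + 1 := by
  classical
  set E₀ : Multiset ((Fin r ⊕ Fin m₃) × (Fin c ⊕ Fin m₂)) :=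
    (∑ i : Fin m₁, ({((Sum.inl (cells i).1 : Fin r ⊕ Fin m₃), (Sum.inl (cells i).2 : Fin c ⊕ Fin m₂))} :
        Multiset ((Fin r ⊕ Fin m₃) × (Fin c ⊕ Fin m₂)))) +
      (∑ i : Fin m₂, ({((Sum.inl (rp i) : Fin r ⊕ Fin m₃), (Sum.inr i : Fin c ⊕ Fin m₂))} :
        Multiset ((Fin r ⊕ Fin m₃) × (Fin c ⊕ Fin m₂)))) +
      (∑ i : Fin m₃, ({((Sum.inr i : Fin r ⊕ Fin m₃), (Sum.inl (cp i) : Fin c ⊕ Fin m₂))} :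
        Multiset ((Fin r ⊕ Fin m₃) × (Fin c ⊕ Fin m₂)))) with hE₀
  have memE₀ : ∀ e ∈ E₀, (∃ i, e = (Sum.inl (cells i).1, Sum.inl (cells i).2)) ∨
      (∃ i, e = (Sum.inl (rp i), Sum.inr i)) ∨ (∃ i, e = (Sum.inr i, Sum.inl (cp i))) := by
    intro e he
    simp only [hE₀, Multiset.mem_add, Multiset.mem_sum, Finset.mem_univ, true_and,
      Multiset.mem_singleton] at he
    rcases he with (⟨i, hi⟩ | ⟨i, hi⟩) | ⟨i, hi⟩
    · exact Or.inl ⟨i, hi⟩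
    · exact Or.inr (Or.inl ⟨i, hi⟩)
    · exact Or.inr (Or.inr ⟨i, hi⟩)
  -- the grid of bags: grid row `i < r` = core row `i` (slot `j = jj + 1` adds the row-pendant `jj` if it hangs at
  -- row `i`), grid row `r + ii` = fresh row `ii`, grid row `r + m₃` = core columns only
  set B : ℕ → ℕ → Finset ((Fin r ⊕ Fin m₃) ⊕ (Fin c ⊕ Fin m₂)) := fun i j =>
    (univ : Finset ((Fin r ⊕ Fin m₃) ⊕ (Fin c ⊕ Fin m₂))).filter (fun v =>
      Sum.elim (Sum.elim (fun a : Fin r => (a : ℕ) = i) (fun ii : Fin m₃ => (ii : ℕ) + r = i))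
        (Sum.elim (fun _ : Fin c => True) (fun jj : Fin m₂ => ((rp jj : Fin r) : ℕ) = i ∧ (jj : ℕ) + 1 = j)) v)
    with hB
  have mem_row : ∀ (i j : ℕ) (a : Fin r),
      (Sum.inl (Sum.inl a) : (Fin r ⊕ Fin m₃) ⊕ (Fin c ⊕ Fin m₂)) ∈ B i j ↔ (a : ℕ) = i := by
    intro i j a; simp [hB]
  have mem_fr : ∀ (i j : ℕ) (ii : Fin m₃),
      (Sum.inl (Sum.inr ii) : (Fin r ⊕ Fin m₃) ⊕ (Fin c ⊕ Fin m₂)) ∈ B i j ↔ (ii : ℕ) + r = i := by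
    intro i j ii; simp [hB]
  have mem_col : ∀ (i j : ℕ) (b : Fin c),
      (Sum.inr (Sum.inl b) : (Fin r ⊕ Fin m₃) ⊕ (Fin c ⊕ Fin m₂)) ∈ B i j := by
    intro i j b; simp [hB]
  have mem_fc : ∀ (i j : ℕ) (jj : Fin m₂),
      (Sum.inr (Sum.inr jj) : (Fin r ⊕ Fin m₃) ⊕ (Fin c ⊕ Fin m₂)) ∈ B i j ↔
        ((rp jj : Fin r) : ℕ) = i ∧ (jj : ℕ) + 1 = j := by
    intro i j jj; simp [hB]
  -- every edge lies in a bag of the grid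
  have key : ∀ e ∈ E₀, ∃ i < r + m₃ + 1, ∃ j < m₂ + 1,
      (Sum.inl e.1 : (Fin r ⊕ Fin m₃) ⊕ (Fin c ⊕ Fin m₂)) ∈ B i j ∧
      (Sum.inr e.2 : (Fin r ⊕ Fin m₃) ⊕ (Fin c ⊕ Fin m₂)) ∈ B i j := by
    intro e he
    rcases memE₀ e he with ⟨k, rfl⟩ | ⟨k, rfl⟩ | ⟨k, rfl⟩
    · have hk := (cells k).1.isLt
      exact ⟨(cells k).1, by omega, 0, by omega, (mem_row _ _ _).2 rfl, mem_col _ _ _⟩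
    · have hk := (rp k).isLt
      have hk' := k.isLt
      exact ⟨rp k, by omega, (k : ℕ) + 1, by omega, (mem_row _ _ _).2 rfl, (mem_fc _ _ _).2 ⟨rfl, rfl⟩⟩
    · have hk := k.isLt
      exact ⟨(k : ℕ) + r, by omega, 0, by omega, (mem_fr _ _ _).2 rfl, mem_col _ _ _⟩
  refine treewidth_le_of_grid _ (N := r + m₃ + 1) (n := m₂ + 1) (by omega) (by omega) B ?_ ?_ ?_ ?_
  · intro u v huv
    rw [SimpleGraph.fromRel_adj] at huv
    obtain ⟨-, h⟩ := huv
    rcases h with ⟨e, he, rfl, rfl⟩ | ⟨e, he, rfl, rfl⟩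
    · exact key e he
    · obtain ⟨i, hi, j, hj, h1, h2⟩ := key e he
      exact ⟨i, hi, j, hj, h2, h1⟩
  · rintro ((a | ii) | (b | jj))
    · have ha := a.isLt
      exact ⟨a, by omega, 0, by omega, (mem_row _ _ _).2 rfl⟩
    · have hii := ii.isLt
      exact ⟨(ii : ℕ) + r, by omega, 0, by omega, (mem_fr _ _ _).2 rfl⟩
    · exact ⟨0, by omega, 0, by omega, mem_col _ _ _⟩
    · have h1 := (rp jj).isLt
      have h2 := jj.isLt
      exact ⟨rp jj, by omega, (jj : ℕ) + 1, by omega, (mem_fc _ _ _).2 ⟨rfl, rfl⟩⟩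
  · intro v i₁ j₁ i j i₂ j₂ _ _ _ _ _ _ h1 h2 hv1 hv2
    rcases v with ((a | ii) | (b | jj))
    · rw [mem_row] at hv1 hv2 ⊢; omega
    · rw [mem_fr] at hv1 hv2 ⊢; omega
    · exact mem_col _ _ _
    · rw [mem_fc] at hv1 hv2 ⊢; omega
  · intro i _ j _
    -- the bag injects into `Option (Option (Fin c))`: rows ↦ none, core column `b` ↦ some (some b),
    -- fresh columns ↦ some none
    set f : (Fin r ⊕ Fin m₃) ⊕ (Fin c ⊕ Fin m₂) → Option (Option (Fin c)) :=
      Sum.elim (fun _ => none) (Sum.elim (fun b => some (some b)) (fun _ => some none)) with hf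
    have hinj : Set.InjOn f (B i j : Set ((Fin r ⊕ Fin m₃) ⊕ (Fin c ⊕ Fin m₂))) := by
      intro x hx y hy hxy
      rw [Finset.mem_coe] at hx hy
      rcases x with ((a | ii) | (b | jj)) <;> rcases y with ((a' | ii') | (b' | jj'))
      all_goals simp only [hf, Sum.elim_inl, Sum.elim_inr, Option.some.injEq, reduceCtorEq] at hxy
      · rw [mem_row] at hx hy
        exact congrArg _ (congrArg _ (Fin.ext (by omega)))
      · rw [mem_row] at hx; rw [mem_fr] at hy
        have := a.isLt; omega
      · rw [mem_fr] at hx; rw [mem_row] at hy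
        have := a'.isLt; omega
      · rw [mem_fr] at hx hy
        exact congrArg _ (congrArg _ (Fin.ext (by omega)))
      · rw [hxy]
      · rw [mem_fc] at hx hy
        exact congrArg _ (congrArg _ (Fin.ext (by omega)))
    refine (Finset.card_le_card_of_injOn f (fun x _ => Finset.mem_univ (f x)) hinj).trans ?_
    simp [Fintype.card_option]

/-- **Core-pattern sums are narrow generators of treewidth `≤ c + 1`** (relabelled to `Fin (r + m₃) × Fin (c + m₂)`).
[folklore] -/
theorem corePattern_mem_narrowSpan_col (n r c m₁ m₂ m₃ : ℕ) (cells : Fin m₁ → Fin r × Fin c) (rp : Fin m₂ → Fin r)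
    (cp : Fin m₃ → Fin c) :
    (∑ φ : Fin r → Fin n, ∑ ψ : Fin c → Fin n,
      (∏ i : Fin m₁, (X (φ (cells i).1, ψ (cells i).2) : MvPolynomial (Fin n × Fin n) ℂ)) *
      (∏ i : Fin m₂, ∑ j : Fin n, (X (φ (rp i), j) : MvPolynomial (Fin n × Fin n) ℂ)) *
      (∏ i : Fin m₃, ∑ j : Fin n, (X (j, ψ (cp i)) : MvPolynomial (Fin n × Fin n) ℂ))) ∈
    Submodule.span ℂ {p : MvPolynomial (Fin n × Fin n) ℂ |
        ∃ (a b : ℕ) (E : Multiset (Fin a × Fin b)),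
          treewidth (SimpleGraph.fromRel fun u v : Fin a ⊕ Fin b =>
            ∃ e ∈ E, u = Sum.inl e.1 ∧ v = Sum.inr e.2) ≤ c + 1 ∧ p = homPoly E n ℂ} := by
  set E₀ : Multiset ((Fin r ⊕ Fin m₃) × (Fin c ⊕ Fin m₂)) :=
    (∑ i : Fin m₁, ({((Sum.inl (cells i).1 : Fin r ⊕ Fin m₃), (Sum.inl (cells i).2 : Fin c ⊕ Fin m₂))} :
        Multiset ((Fin r ⊕ Fin m₃) × (Fin c ⊕ Fin m₂)))) +
      (∑ i : Fin m₂, ({((Sum.inl (rp i) : Fin r ⊕ Fin m₃), (Sum.inr i : Fin c ⊕ Fin m₂))} :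
        Multiset ((Fin r ⊕ Fin m₃) × (Fin c ⊕ Fin m₂)))) +
      (∑ i : Fin m₃, ({((Sum.inr i : Fin r ⊕ Fin m₃), (Sum.inl (cp i) : Fin c ⊕ Fin m₂))} :
        Multiset ((Fin r ⊕ Fin m₃) × (Fin c ⊕ Fin m₂)))) with hE₀
  refine Submodule.subset_span ⟨r + m₃, c + m₂, E₀.map fun e => (finSumFinEquiv e.1, finSumFinEquiv e.2), ?_, ?_⟩
  · refine (NarrowSpanAlgebra.treewidth_patternGraph_map_equiv_le E₀ finSumFinEquiv finSumFinEquiv).trans ?_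
    rw [hE₀]
    exact treewidth_corePattern_le_col r c m₁ m₂ m₃ cells rp cp
  · rw [HomPolyBasics.homPoly_map_equiv, hE₀, homPoly_corePattern]

/-! ### The separable engine -/

/-- **THE SEPARABLE ENGINE: all-placements sums of a polynomial in the local atoms are narrow, treewidth `≤ c + 1`,
for ANY number of core rows.**  For every `P ∈ MvPolynomial ((Fin r × Fin c) ⊕ (Fin r ⊕ Fin c)) ℂ` (atoms: cells
`x_{ab}`, row sums `R_a`, column sums `C_b`),
`Σ_{φ, ψ} P(x_{φ a, ψ b}, R_{φ a}, C_{ψ b}) ∈ span_ℂ {hom_{F,n} : tw F ≤ c + 1}`.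
[folklore; cite: DwivediPagoSeppelt2026, §8] -/
theorem sum_placements_aeval_mem_narrowSpan_col (n r c : ℕ) (P : MvPolynomial ((Fin r × Fin c) ⊕ (Fin r ⊕ Fin c)) ℂ) :
    (∑ φ : Fin r → Fin n, ∑ ψ : Fin c → Fin n,
      aeval (Sum.elim (fun ab : Fin r × Fin c => (X (φ ab.1, ψ ab.2) : MvPolynomial (Fin n × Fin n) ℂ))
          (Sum.elim (fun a : Fin r => ∑ j : Fin n, (X (φ a, j) : MvPolynomial (Fin n × Fin n) ℂ))
            (fun b : Fin c => ∑ j : Fin n, (X (j, ψ b) : MvPolynomial (Fin n × Fin n) ℂ)))) P) ∈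
    Submodule.span ℂ {p : MvPolynomial (Fin n × Fin n) ℂ |
        ∃ (a b : ℕ) (E : Multiset (Fin a × Fin b)),
          treewidth (SimpleGraph.fromRel fun u v : Fin a ⊕ Fin b =>
            ∃ e ∈ E, u = Sum.inl e.1 ∧ v = Sum.inr e.2) ≤ c + 1 ∧ p = homPoly E n ℂ} := by
  classical
  -- expand `P` into monomials
  have hP : ∀ (φ : Fin r → Fin n) (ψ : Fin c → Fin n),
      aeval (Sum.elim (fun ab : Fin r × Fin c => (X (φ ab.1, ψ ab.2) : MvPolynomial (Fin n × Fin n) ℂ))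
          (Sum.elim (fun a : Fin r => ∑ j : Fin n, (X (φ a, j) : MvPolynomial (Fin n × Fin n) ℂ))
            (fun b : Fin c => ∑ j : Fin n, (X (j, ψ b) : MvPolynomial (Fin n × Fin n) ℂ)))) P =
      ∑ s ∈ P.support, C (coeff s P) *
        s.prod (fun t k => (Sum.elim (fun ab : Fin r × Fin c => (X (φ ab.1, ψ ab.2) : MvPolynomial (Fin n × Fin n) ℂ))
          (Sum.elim (fun a : Fin r => ∑ j : Fin n, (X (φ a, j) : MvPolynomial (Fin n × Fin n) ℂ))
            (fun b : Fin c => ∑ j : Fin n, (X (j, ψ b) : MvPolynomial (Fin n × Fin n) ℂ))) t) ^ k) := by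
    intro φ ψ
    conv_lhs => rw [P.as_sum]
    rw [map_sum]
    refine Finset.sum_congr rfl fun s _ => ?_
    rw [aeval_monomial, algebraMap_eq]
  simp_rw [hP]
  rw [sum_sum_sum_comm]
  refine Submodule.sum_mem _ fun s _ => ?_
  obtain ⟨K, w, hw⟩ := exists_word_of_finsupp s
  obtain ⟨m₁, cells, m₂, rp, m₃, cp, h⟩ := exists_lists_of_word r c K w
  have hterm : ∀ (φ : Fin r → Fin n) (ψ : Fin c → Fin n),
      C (coeff s P) *
        s.prod (fun t k => (Sum.elim (fun ab : Fin r × Fin c => (X (φ ab.1, ψ ab.2) : MvPolynomial (Fin n × Fin n) ℂ))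
          (Sum.elim (fun a : Fin r => ∑ j : Fin n, (X (φ a, j) : MvPolynomial (Fin n × Fin n) ℂ))
            (fun b : Fin c => ∑ j : Fin n, (X (j, ψ b) : MvPolynomial (Fin n × Fin n) ℂ))) t) ^ k) =
      C (coeff s P) *
        ((∏ i : Fin m₁, (X (φ (cells i).1, ψ (cells i).2) : MvPolynomial (Fin n × Fin n) ℂ)) *
          (∏ i : Fin m₂, ∑ j : Fin n, (X (φ (rp i), j) : MvPolynomial (Fin n × Fin n) ℂ)) *
          (∏ i : Fin m₃, ∑ j : Fin n, (X (j, ψ (cp i)) : MvPolynomial (Fin n × Fin n) ℂ))) := by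
    intro φ ψ
    rw [hw (MvPolynomial (Fin n × Fin n) ℂ), h n φ ψ]
  simp_rw [hterm]
  simp_rw [← Finset.mul_sum]
  rw [← MvPolynomial.smul_eq_C_mul]
  exact Submodule.smul_mem _ _ (corePattern_mem_narrowSpan_col n r c m₁ m₂ m₃ cells rp cp)

/-- **INJ, row side, treewidth `≤ c + 1`.**  The sum over INJECTIVE row placements (all column placements) of a
polynomial in the local atoms lies in `span_ℂ {hom_{F,n} : tw F ≤ c + 1}`. [folklore; cite: DwivediPagoSeppelt2026, §8] -/
theorem sum_injective_placements_aeval_mem_narrowSpan_col (n r c : ℕ)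
    (P : MvPolynomial ((Fin r × Fin c) ⊕ (Fin r ⊕ Fin c)) ℂ) :
    (∑ φ ∈ (univ : Finset (Fin r → Fin n)).filter (fun φ => Function.Injective φ), ∑ ψ : Fin c → Fin n,
      aeval (Sum.elim (fun ab : Fin r × Fin c => (X (φ ab.1, ψ ab.2) : MvPolynomial (Fin n × Fin n) ℂ))
        (Sum.elim (fun a : Fin r => ∑ j : Fin n, (X (φ a, j) : MvPolynomial (Fin n × Fin n) ℂ))
          (fun b : Fin c => ∑ j : Fin n, (X (j, ψ b) : MvPolynomial (Fin n × Fin n) ℂ)))) P) ∈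
    Submodule.span ℂ {p : MvPolynomial (Fin n × Fin n) ℂ |
        ∃ (a b : ℕ) (E : Multiset (Fin a × Fin b)),
          treewidth (SimpleGraph.fromRel fun u v : Fin a ⊕ Fin b =>
            ∃ e ∈ E, u = Sum.inl e.1 ∧ v = Sum.inr e.2) ≤ c + 1 ∧ p = homPoly E n ℂ} := by
  classical
  refine sum_injective_mem_of_merge _ r n _ fun r' π _ => ?_
  simp_rw [aeval_atoms_comp_rows n r r' c P π]
  exact sum_placements_aeval_mem_narrowSpan_col n r' c (rename (Sum.map (Prod.map π id) (Sum.map π id)) P)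

/-- **INJ, both sides, treewidth `≤ c + 1`.**  The sum over injective row AND injective column placements of a
polynomial in the local atoms lies in `span_ℂ {hom_{F,n} : tw F ≤ c + 1}`. [folklore; cite: DwivediPagoSeppelt2026, §8] -/
theorem sum_injective_injective_aeval_mem_narrowSpan_col (n r c : ℕ)
    (P : MvPolynomial ((Fin r × Fin c) ⊕ (Fin r ⊕ Fin c)) ℂ) :
    (∑ φ ∈ (univ : Finset (Fin r → Fin n)).filter (fun φ => Function.Injective φ),
      ∑ ψ ∈ (univ : Finset (Fin c → Fin n)).filter (fun ψ => Function.Injective ψ),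
      aeval (Sum.elim (fun ab : Fin r × Fin c => (X (φ ab.1, ψ ab.2) : MvPolynomial (Fin n × Fin n) ℂ))
        (Sum.elim (fun a : Fin r => ∑ j : Fin n, (X (φ a, j) : MvPolynomial (Fin n × Fin n) ℂ))
          (fun b : Fin c => ∑ j : Fin n, (X (j, ψ b) : MvPolynomial (Fin n × Fin n) ℂ)))) P) ∈
    Submodule.span ℂ {p : MvPolynomial (Fin n × Fin n) ℂ |
        ∃ (a b : ℕ) (E : Multiset (Fin a × Fin b)),
          treewidth (SimpleGraph.fromRel fun u v : Fin a ⊕ Fin b =>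
            ∃ e ∈ E, u = Sum.inl e.1 ∧ v = Sum.inr e.2) ≤ c + 1 ∧ p = homPoly E n ℂ} := by
  classical
  rw [Finset.sum_comm]
  refine sum_injective_mem_of_merge _ c n _ fun c' π hπ => ?_
  have hc'le : c' ≤ c := by
    have := Fintype.card_le_of_surjective π hπ
    simpa using this
  simp_rw [aeval_atoms_comp_cols n r c c' P π]
  rw [Finset.sum_comm]
  refine (Submodule.span_mono ?_)
    (sum_injective_placements_aeval_mem_narrowSpan_col n r c' (rename (Sum.map (Prod.map id π) (Sum.map id π)) P))
  rintro p ⟨a, b, E, hE, rfl⟩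
  exact ⟨a, b, E, hE.trans (by omega), rfl⟩

end CorePatterns

end Summit.ValiantsHypothesis.ValiantsHypothesis.Theorems

end
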